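import Mathlib
import HarnessLib
import Literature.Geometry.Lorentzian.QuasiFinalStateDecomposition
import Literature.Geometry.Lorentzian.TimeCones
import Summits.FinalStateConjecture.FinalStateConjecture.Theorems.LogTimeThreeAnnuliDyadicCaptureSettledRechart
import Summits.FinalStateConjecture.FinalStateConjecture.Theorems.LogTimeThreeAnnuliDyadicCaptureHonestRechart

/-!
# Stub `stub_normalisedEraTwoOfConcl` of the line `registered` of crux `LogTimeThreeAnnuli.DyadicCapture`
# (stmt-FinalStateConjecture-17488, skeleton v7, stub B — backward / necessity):
# a settled `C²` decomposition IS a `C⁰`-normalised honest era at order two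

For ONE maximal development `𝒟`, the Statement's settling conjunct `CONCL(𝒟)` — a `C²` final state
decomposition `d'` of `O' ⊆ 𝒟.carrier` with sub-extremal holes, `O' = exteriorOf 𝒟 d'.charted`,
rays staying in `closure O'`, exhaustive charts and future-oriented chart times — already provides
the `C⁰`-normalised honest era system at order two asked for by the open stub `stub_normalisedEraTwo`
of the skeleton: the reference system is the forgetful image `d := d'.toQuasi _`
(`FinalStateDecomposition.toQuasi`, `⊤ > 0`; `charted`, `certifiedLate`, `certifiedSlab`,
`background` agree by `rfl`), `O := O'`, the radii `R` are those of `HasExhaustiveCharts d'`, the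
window `[m₀, m₀⁻¹] × {|a| ≤ χ M}` is any window around the finitely many labels `(Mᵢ, aᵢ)`
(`dyadicNecessity_window`: `m₀ := (1 + Σᵢ (Mᵢ + Mᵢ⁻¹))⁻¹`, `χ := 1 − (1 + Σᵢ (1 − |aᵢ|/Mᵢ)⁻¹)⁻¹`),
windowed closeness is witnessed by the labels themselves, the `C⁰` normalisation is monotonicity of
the `Cᵏ` sup norms in `k`, and the one genuine lemma is the COVECTOR orientation clause from the
VECTOR form (ii) of `Summit.FinalStateConjecture.IsFutureOriented` plus `C⁰` closeness
(`dyadicNecessity_pos_apply_zero`, the mirror image of `dyadicCapture_isFutureDirected_pushforward`).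

Mechanism of the orientation lemma (O'Neill 1983, Ch. 5, Lemma 5.29 and p. 145;
Dafermos–Rodnianski arXiv:0811.0354, §5.1). At a point `x` of the truncated slab put
`z = Λ⁻¹(x − c)`, `V = V_{M,a}(z) = −g♯(dt*)`, `u = Λ V`, `U = dΨ u` (future-directed by (ii)),
and let `W = dΨ w`, `w = Λ X`, be future-directed causal. The background values are
`B(u, w) = g_{M,a}(V, X) = −X⁰` (`Kerr.bilin_timeVector`) and
`B(w, w) = η(X, X) + 2H ℓ(X)² ≥ −(X⁰)² + |X⃗|²` (`H ≥ 0`). With the `C⁰` deviation `≤ δ`,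
`8 ‖Λ‖² δ ≤ 1`: causality `g(W, W) ≤ 0` gives `|X⃗|² − (X⁰)² ≤ δ ‖Λ‖² ‖X‖²`, whence
`‖X‖² ≤ 4 (X⁰)²`; and `g(U, W) ≤ 0` (two future-directed causal vectors,
`IsFutureDirected.val_nonpos`) gives `−X⁰ ≤ δ ‖u‖ ‖w‖ ≤ δ √13 ‖Λ‖ · ‖Λ‖ · 2 |X⁰|`, so `X⁰ ≤ 0`
would force `X⁰ = 0`, `X = 0`, `W = 0` — not causal. Hence `(Λ⁻¹ w)⁰ = X⁰ > 0`.
-/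

-- the `Summit.FinalStateConjecture.FinalStateConjecture.…` namespace repeats the summit = sub-problem
-- segment (D-0017); deliberate.
set_option linter.dupNamespace false

noncomputable section

namespace Summit.FinalStateConjecture.FinalStateConjecture.Theorems

open Literature.Geometry.Lorentzian
open scoped Topology Manifold ENNReal ContDiff
open Filter Set

/-- **Real-algebra core of the orientation lemma.** With `K = ‖Λ‖²`, `8 K δ ≤ 1`,
`‖u‖² ≤ 13 K`, `‖w‖² ≤ K ‖X‖²`, `‖X‖² = p² + S` (`p = X⁰`, `S = |X⃗|² ≥ 0`, `E = 2H ℓ(X)² ≥ 0`),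
causality `g(W,W) ≤ 0` with `|g(W,W) − (−p² + S + E)| ≤ δ ‖w‖²`, and `g(U,W) ≤ 0` with
`|g(U,W) + p| ≤ δ ‖u‖ ‖w‖`: if `p ≤ 0` then `‖X‖ = 0` (first `‖X‖² ≤ 4 p²`, then
`p² ≤ 52 (Kδ)² p² ≤ (52/64) p²`). [folklore] -/
theorem dyadicNecessity_real_core {δ K nu nw nX p S E gUW gWW : ℝ}
    (hδ : 0 ≤ δ) (hK : 0 ≤ K) (hδK : 8 * K * δ ≤ 1)
    (hu2 : nu ^ 2 ≤ 13 * K) (hw2 : nw ^ 2 ≤ K * nX ^ 2)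
    (hX2 : nX ^ 2 = p ^ 2 + S) (hS : 0 ≤ S) (hE : 0 ≤ E)
    (hWW : gWW ≤ 0) (hdevW : |gWW - (-(p * p) + S + E)| ≤ δ * nw * nw)
    (hUW : gUW ≤ 0) (hdevU : |gUW - (-p)| ≤ δ * nu * nw)
    (hp : p ≤ 0) : nX = 0 := by
  rw [abs_le] at hdevW hdevU
  -- (i) causality of `W` and `C⁰` closeness: `S - p² ≤ δ ‖w‖² ≤ δ K ‖X‖² ≤ ‖X‖² / 8`
  have h1 : S - p ^ 2 ≤ δ * nw * nw := by nlinarith [hdevW.1]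
  have h2 : δ * nw * nw ≤ δ * (K * (p ^ 2 + S)) := by
    rw [mul_assoc, ← pow_two, ← hX2]
    exact mul_le_mul_of_nonneg_left hw2 hδ
  have h3 : 8 * K * δ * (p ^ 2 + S) ≤ 1 * (p ^ 2 + S) :=
    mul_le_mul_of_nonneg_right hδK (add_nonneg (sq_nonneg p) hS)
  have h4 : nX ^ 2 ≤ 4 * p ^ 2 := by nlinarith [sq_nonneg p]
  -- (ii) `-p ≤ δ ‖u‖ ‖w‖`, and if `p ≤ 0` then `p² ≤ 52 (δK)² p² ≤ (52/64) p²`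
  have h5 : -p ≤ δ * nu * nw := by linarith [hdevU.1]
  have h6 : p ^ 2 ≤ (δ * nu * nw) ^ 2 := by
    have := pow_le_pow_left₀ (neg_nonneg.2 hp) h5 2
    rwa [neg_sq] at this
  have h7 : nu ^ 2 * nw ^ 2 ≤ 13 * K * (K * nX ^ 2) :=
    mul_le_mul hu2 hw2 (sq_nonneg _) (by positivity)
  have h8 : 13 * K * (K * nX ^ 2) ≤ 13 * K * (K * (4 * p ^ 2)) :=
    mul_le_mul_of_nonneg_left (mul_le_mul_of_nonneg_left h4 hK) (by positivity)
  have h9 : (δ * nu * nw) ^ 2 = δ ^ 2 * (nu ^ 2 * nw ^ 2) := by ring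
  have h10 : δ ^ 2 * (nu ^ 2 * nw ^ 2) ≤ δ ^ 2 * (13 * K * (K * (4 * p ^ 2))) :=
    mul_le_mul_of_nonneg_left (h7.trans h8) (sq_nonneg δ)
  have h11 : (8 * K * δ) ^ 2 ≤ 1 ^ 2 := pow_le_pow_left₀ (by positivity) hδK 2
  have h12 : (K * δ) ^ 2 * p ^ 2 ≤ (1 / 64) * p ^ 2 :=
    mul_le_mul_of_nonneg_right (by nlinarith [h11]) (sq_nonneg p)
  have h13 : p ^ 2 ≤ 0 := by nlinarith [h6, h9, h10, h12]
  have h14 : nX ^ 2 = 0 := le_antisymm (by nlinarith [h4, h13]) (sq_nonneg _)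
  exact pow_eq_zero_iff two_ne_zero |>.1 h14

/-- **Pointwise covector orientation from the vector orientation** (mirror image of
`dyadicCapture_isFutureDirected_pushforward`). On the boosted sub-extremal Kerr background with
chart map `Ψ`, at a point `x` of the truncated slab `{t* = τ, r ≤ ρ}` where `Ψ^* g` is `δ`-close
in `C⁰` to `boostedKerrBilin` with `8 ‖Λ‖² δ ≤ 1` and where the push-forward `U = dΨ (Λ V)` of the
background's future timelike field `V = −g♯_{M,a}(dt*)` is future-directed, every `X` whose
push-forward `W = dΨ (Λ X)` is future-directed causal has `X⁰ > 0`: `g(U, W) ≤ 0` (O'Neill 1983,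
Ch. 5, Lemma 5.29) is `δ ‖ΛV‖ ‖ΛX‖`-close to `B(ΛV, ΛX) = g_{M,a}(V, X) = −X⁰`, and causality
`g(W, W) ≤ 0` is `δ ‖ΛX‖²`-close to `g_{M,a}(X, X) = η(X, X) + 2H ℓ(X)² ≥ −(X⁰)² + |X⃗|²`, which
pins `‖X‖ ≤ 2 |X⁰|`; so `X⁰ ≤ 0` forces `X = 0`, contradicting `W ≠ 0`. O'Neill 1983, Ch. 5,
p. 145; Dafermos–Rodnianski arXiv:0811.0354, §5.1 (`∇t*` timelike on `{r > 0}`).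
[cite: ONeill1983, Ch. 5  p. 145] [cite: arXiv08110354, §5.1] -/
theorem dyadicNecessity_pos_apply_zero {𝓢 : Spacetime 4} (Λ : lorentzGroup) (c : E4) {M a : ℝ}
    (hMa : Kerr.IsSubextremal M a) (Ψ : (boostedKerrBackground Λ c M a).domain → 𝓢.carrier)
    {ρ τ δ : ℝ} (hδ : 0 ≤ δ) (hδΛ : 8 * ‖((Λ : E4 ≃L[ℝ] E4) : E4 →L[ℝ] E4)‖ ^ 2 * δ ≤ 1)
    (h : 𝓢.truncDeviationCk (boostedKerrBackground Λ c M a) Ψ 0 ρ τ ≤ ENNReal.ofReal δ)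
    {x : (boostedKerrBackground Λ c M a).domain}
    (hx : x ∈ (boostedKerrBackground Λ c M a).truncTimeSlab ρ τ)
    (hvec : 𝓢.timeOrientation.IsFutureDirected (mfderiv 𝓘(ℝ, E4) (𝓡 4) Ψ x
      ((Λ : E4 ≃L[ℝ] E4) (Kerr.timeVector M a (poincareInv Λ c (x : E4))))))
    (X : E4)
    (hW : 𝓢.timeOrientation.IsFutureDirected (mfderiv 𝓘(ℝ, E4) (𝓡 4) Ψ x
      ((Λ : E4 ≃L[ℝ] E4) X))) :
    0 < X 0 := by
  set z : E4 := poincareInv Λ c (x : E4) with hz_def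
  have hz : z ∈ Kerr.exterior M a := mem_boostedKerrExterior.1 x.2
  have hr0 : 0 < Kerr.radius a z := Kerr.radius_pos_of_mem_region hz
  have hH0 : 0 ≤ Kerr.scalarH M a z := Kerr.scalarH_nonneg hMa.pos.le a z
  set V : E4 := Kerr.timeVector M a z with hV_def
  set u : E4 := (Λ : E4 ≃L[ℝ] E4) V with hu_def
  set w : E4 := (Λ : E4 ≃L[ℝ] E4) X with hw_def
  -- the background values `B(u, w) = g_{M,a}(V, X) = -X⁰` and `B(w, w) = η(X, X) + 2H ℓ(X)²`
  have hBuw : (boostedKerrBackground Λ c M a).bilin (x : E4) u w = -X 0 := by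
    change boostedKerrBilin Λ c M a (x : E4) u w = _
    rw [boostedKerrBilin_apply, hu_def, hw_def, ContinuousLinearEquiv.symm_apply_apply,
      ContinuousLinearEquiv.symm_apply_apply]
    exact Kerr.bilin_timeVector hr0 X
  have hBww : (boostedKerrBackground Λ c M a).bilin (x : E4) w w =
      -(X 0 * X 0) + ∑ i : Fin 3, X i.succ * X i.succ +
        2 * Kerr.scalarH M a z * (Kerr.nullCovector a z X * Kerr.nullCovector a z X) := by
    change boostedKerrBilin Λ c M a (x : E4) w w = _
    rw [boostedKerrBilin_apply, hw_def, ContinuousLinearEquiv.symm_apply_apply, ← hz_def,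
      Kerr.bilin_apply, Minkowski.bilin_apply]
  -- the norm bounds `‖u‖² ≤ 13 ‖Λ‖²`, `‖w‖² ≤ ‖Λ‖² ‖X‖²`, `‖X‖² = (X⁰)² + |X⃗|²`
  have hu_norm : ‖u‖ ^ 2 ≤ 13 * ‖((Λ : E4 ≃L[ℝ] E4) : E4 →L[ℝ] E4)‖ ^ 2 := by
    -- adapted from `dyadicCapture_isFutureDirected_pushforward`
    have h1 : ‖u‖ ≤ ‖((Λ : E4 ≃L[ℝ] E4) : E4 →L[ℝ] E4)‖ * ‖V‖ :=
      ((Λ : E4 ≃L[ℝ] E4) : E4 →L[ℝ] E4).le_opNorm V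
    have h2 : ‖V‖ ^ 2 ≤ 13 := dyadicCapture_norm_timeVector_sq_le hMa hz
    calc ‖u‖ ^ 2 ≤ (‖((Λ : E4 ≃L[ℝ] E4) : E4 →L[ℝ] E4)‖ * ‖V‖) ^ 2 :=
          pow_le_pow_left₀ (norm_nonneg _) h1 2
      _ = ‖((Λ : E4 ≃L[ℝ] E4) : E4 →L[ℝ] E4)‖ ^ 2 * ‖V‖ ^ 2 := mul_pow _ _ 2
      _ ≤ ‖((Λ : E4 ≃L[ℝ] E4) : E4 →L[ℝ] E4)‖ ^ 2 * 13 :=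
          mul_le_mul_of_nonneg_left h2 (sq_nonneg _)
      _ = 13 * ‖((Λ : E4 ≃L[ℝ] E4) : E4 →L[ℝ] E4)‖ ^ 2 := mul_comm _ _
  have hw_norm : ‖w‖ ^ 2 ≤ ‖((Λ : E4 ≃L[ℝ] E4) : E4 →L[ℝ] E4)‖ ^ 2 * ‖X‖ ^ 2 := by
    rw [← mul_pow]
    exact pow_le_pow_left₀ (norm_nonneg _) (((Λ : E4 ≃L[ℝ] E4) : E4 →L[ℝ] E4).le_opNorm X) 2
  have hX_norm : ‖X‖ ^ 2 = X 0 ^ 2 + ∑ i : Fin 3, X i.succ * X i.succ := by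
    rw [EuclideanSpace.real_norm_sq_eq, Fin.sum_univ_succ]
    simp only [sq]
  -- the `C⁰` deviation bounds at `x`
  have hdevU := dyadicCapture_abs_pullback_sub_bilin_le _ Ψ hδ h hx u w
  have hdevW := dyadicCapture_abs_pullback_sub_bilin_le _ Ψ hδ h hx w w
  rw [hBuw] at hdevU
  rw [hBww] at hdevW
  -- causal characters: `g(W, W) ≤ 0` and `g(U, W) ≤ 0` (two future-directed causal vectors)
  have hWW : 𝓢.metric.val (Ψ x) (mfderiv 𝓘(ℝ, E4) (𝓡 4) Ψ x w)
      (mfderiv 𝓘(ℝ, E4) (𝓡 4) Ψ x w) ≤ 0 := hW.1.1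
  have hUW : 𝓢.metric.val (Ψ x) (mfderiv 𝓘(ℝ, E4) (𝓡 4) Ψ x u)
      (mfderiv 𝓘(ℝ, E4) (𝓡 4) Ψ x w) ≤ 0 := hvec.val_nonpos 𝓢.timeOrientation hW
  by_contra hp
  rw [not_lt] at hp
  have hX0 : ‖X‖ = 0 :=
    dyadicNecessity_real_core hδ (sq_nonneg _) hδΛ hu_norm hw_norm hX_norm
      (Finset.sum_nonneg fun i _ => mul_self_nonneg _)
      (mul_nonneg (mul_nonneg zero_le_two hH0) (mul_self_nonneg _)) hWW hdevW hUW hdevU hp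
  have hX : X = 0 := norm_eq_zero.1 hX0
  apply hW.1.2
  rw [hw_def, hX, map_zero]
  exact map_zero _

/-- **Pointwise covector orientation clause** (the form consumed by the era signatures): under the
hypotheses of `dyadicNecessity_pos_apply_zero`, every `w` with future-directed push-forward `dΨ w`
has `(Λ⁻¹ w)⁰ > 0` (apply the previous lemma to `X = Λ⁻¹ w`, `w = Λ X`). O'Neill 1983, Ch. 5,
p. 145; Dafermos–Rodnianski arXiv:0811.0354, §5.1.
[cite: ONeill1983, Ch. 5  p. 145] [cite: arXiv08110354, §5.1] -/
theorem dyadicNecessity_pos_symm_apply_zero {𝓢 : Spacetime 4} (Λ : lorentzGroup) (c : E4)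
    {M a : ℝ} (hMa : Kerr.IsSubextremal M a)
    (Ψ : (boostedKerrBackground Λ c M a).domain → 𝓢.carrier)
    {ρ τ δ : ℝ} (hδ : 0 ≤ δ) (hδΛ : 8 * ‖((Λ : E4 ≃L[ℝ] E4) : E4 →L[ℝ] E4)‖ ^ 2 * δ ≤ 1)
    (h : 𝓢.truncDeviationCk (boostedKerrBackground Λ c M a) Ψ 0 ρ τ ≤ ENNReal.ofReal δ)
    {x : (boostedKerrBackground Λ c M a).domain}
    (hx : x ∈ (boostedKerrBackground Λ c M a).truncTimeSlab ρ τ)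
    (hvec : 𝓢.timeOrientation.IsFutureDirected (mfderiv 𝓘(ℝ, E4) (𝓡 4) Ψ x
      ((Λ : E4 ≃L[ℝ] E4) (Kerr.timeVector M a (poincareInv Λ c (x : E4)))))) :
    ∀ w : E4, 𝓢.timeOrientation.IsFutureDirected (mfderiv 𝓘(ℝ, E4) (𝓡 4) Ψ x w) →
      0 < (Λ : E4 ≃L[ℝ] E4).symm w 0 := by
  intro w hW
  refine dyadicNecessity_pos_apply_zero Λ c hMa Ψ hδ hδΛ h hx hvec _ ?_
  rwa [ContinuousLinearEquiv.apply_symm_apply]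

/-- **Eventual covector orientation clause on truncated slabs.** If the `Cᵏ` deviation of `Ψ^* g`
from boosted sub-extremal Kerr on `{t* = τ, r ≤ ρ}` tends to `0` and eventually the push-forward of
`Λ V_{M,a}(Λ⁻¹(x − c))` is future-directed at every point of these slabs (clause (ii) of
`Summit.FinalStateConjecture.IsFutureOriented`), then eventually every `w` with future-directed
push-forward at a point of the slab has `(Λ⁻¹ w)⁰ > 0` (choose `δ = 1/(8 ‖Λ‖² + 8)` and apply
`dyadicNecessity_pos_symm_apply_zero`; the order-`0` deviation is at most the order-`k` one).
O'Neill 1983, Ch. 5, p. 145; Dafermos–Rodnianski arXiv:0811.0354, §5.1.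
[cite: ONeill1983, Ch. 5  p. 145] [cite: arXiv08110354, §5.1] -/
theorem dyadicNecessity_eventually_pos_symm_apply_zero {𝓢 : Spacetime 4} (Λ : lorentzGroup)
    (c : E4) {M a : ℝ} (hMa : Kerr.IsSubextremal M a)
    (Ψ : (boostedKerrBackground Λ c M a).domain → 𝓢.carrier) {k : ℕ} (ρ : ℝ)
    (hconv : Tendsto (fun τ ↦ 𝓢.truncDeviationCk (boostedKerrBackground Λ c M a) Ψ k ρ τ)
      atTop (𝓝 0))
    (hvec : ∀ᶠ τ in atTop, ∀ x ∈ (boostedKerrBackground Λ c M a).truncTimeSlab ρ τ,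
      𝓢.timeOrientation.IsFutureDirected (mfderiv 𝓘(ℝ, E4) (𝓡 4) Ψ x
        ((Λ : E4 ≃L[ℝ] E4) (Kerr.timeVector M a (poincareInv Λ c (x : E4)))))) :
    ∀ᶠ τ in atTop, ∀ x ∈ (boostedKerrBackground Λ c M a).truncTimeSlab ρ τ, ∀ w : E4,
      𝓢.timeOrientation.IsFutureDirected (mfderiv 𝓘(ℝ, E4) (𝓡 4) Ψ x w) →
        0 < (Λ : E4 ≃L[ℝ] E4).symm w 0 := by
  -- adapted from `dyadicCapture_eventually_isFutureDirected`
  set K : ℝ := ‖((Λ : E4 ≃L[ℝ] E4) : E4 →L[ℝ] E4)‖ ^ 2 with hK_def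
  have hK : 0 ≤ K := sq_nonneg _
  set δ : ℝ := 1 / (8 * K + 8) with hδ_def
  have hδpos : 0 < δ := by positivity
  have hδΛ : 8 * K * δ ≤ 1 := by
    rw [hδ_def, mul_one_div, div_le_one (by positivity)]
    linarith
  have hev : ∀ᶠ τ in atTop,
      𝓢.truncDeviationCk (boostedKerrBackground Λ c M a) Ψ k ρ τ ≤ ENNReal.ofReal δ :=
    ENNReal.tendsto_nhds_zero.1 hconv _ (ENNReal.ofReal_pos.2 hδpos)
  filter_upwards [hev, hvec] with τ hτ hvecτ x hx
  have h0 : 𝓢.truncDeviationCk (boostedKerrBackground Λ c M a) Ψ 0 ρ τ ≤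
      𝓢.truncDeviationCk (boostedKerrBackground Λ c M a) Ψ k ρ τ :=
    supCkENorm_mono_right _ (Nat.zero_le k) _
  exact dyadicNecessity_pos_symm_apply_zero Λ c hMa Ψ hδpos.le hδΛ (h0.trans hτ) hx (hvecτ x hx)

/-- **A window around finitely many sub-extremal labels.** For `0 < Mᵢ`, `|aᵢ| < Mᵢ`
(`i < n`), `m₀ := (1 + Σᵢ (Mᵢ + Mᵢ⁻¹))⁻¹ > 0` and `χ := 1 − (1 + Σᵢ (1 − |aᵢ|/Mᵢ)⁻¹)⁻¹ < 1` satisfy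
`m₀ ≤ Mᵢ ≤ m₀⁻¹` and `|aᵢ| ≤ χ Mᵢ` for every `i` (each positive summand is at most the sum).
Pure real bookkeeping. [folklore] -/
theorem dyadicNecessity_window {n : ℕ} (M a : Fin n → ℝ) (h : ∀ i, 0 < M i ∧ |a i| < M i) :
    ∃ m₀ χ : ℝ, 0 < m₀ ∧ χ < 1 ∧ ∀ i, m₀ ≤ M i ∧ M i ≤ m₀⁻¹ ∧ |a i| ≤ χ * M i := by
  have hq : ∀ i, 0 < 1 - |a i| / M i := fun i => by
    rw [sub_pos, div_lt_one (h i).1]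
    exact (h i).2
  have hA : 0 < 1 + ∑ i, (M i + (M i)⁻¹) := by
    have : 0 ≤ ∑ i, (M i + (M i)⁻¹) :=
      Finset.sum_nonneg fun i _ => by have := (h i).1; positivity
    linarith
  have hA' : 0 < 1 + ∑ i, (1 - |a i| / M i)⁻¹ := by
    have : 0 ≤ ∑ i, (1 - |a i| / M i)⁻¹ := Finset.sum_nonneg fun i _ => (inv_pos.2 (hq i)).le
    linarith
  refine ⟨(1 + ∑ i, (M i + (M i)⁻¹))⁻¹, 1 - (1 + ∑ i, (1 - |a i| / M i)⁻¹)⁻¹, inv_pos.2 hA,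
    by linarith [inv_pos.2 hA'], fun i => ⟨?_, ?_, ?_⟩⟩
  · have hle : M i + (M i)⁻¹ ≤ ∑ j, (M j + (M j)⁻¹) :=
      Finset.single_le_sum (f := fun j => M j + (M j)⁻¹)
        (fun j _ => by have := (h j).1; positivity) (Finset.mem_univ i)
    calc (1 + ∑ j, (M j + (M j)⁻¹))⁻¹ ≤ ((M i)⁻¹)⁻¹ :=
          inv_anti₀ (inv_pos.2 (h i).1) (by linarith [(h i).1])
      _ = M i := inv_inv _
  · rw [inv_inv]
    have hle : M i + (M i)⁻¹ ≤ ∑ j, (M j + (M j)⁻¹) :=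
      Finset.single_le_sum (f := fun j => M j + (M j)⁻¹)
        (fun j _ => by have := (h j).1; positivity) (Finset.mem_univ i)
    linarith [inv_pos.2 (h i).1]
  · have hMi := (h i).1
    have hle : (1 - |a i| / M i)⁻¹ ≤ ∑ j, (1 - |a j| / M j)⁻¹ :=
      Finset.single_le_sum (f := fun j => (1 - |a j| / M j)⁻¹)
        (fun j _ => (inv_pos.2 (hq j)).le) (Finset.mem_univ i)
    have h2 : (1 + ∑ j, (1 - |a j| / M j)⁻¹)⁻¹ ≤ 1 - |a i| / M i :=
      calc (1 + ∑ j, (1 - |a j| / M j)⁻¹)⁻¹ ≤ ((1 - |a i| / M i)⁻¹)⁻¹ :=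
            inv_anti₀ (inv_pos.2 (hq i)) (by linarith)
        _ = 1 - |a i| / M i := inv_inv _
    have h3 : (1 - |a i| / M i) * M i = M i - |a i| := by
      rw [sub_mul, one_mul, div_mul_cancel₀ _ hMi.ne']
    have h4 : (1 + ∑ j, (1 - |a j| / M j)⁻¹)⁻¹ * M i ≤ (1 - |a i| / M i) * M i :=
      mul_le_mul_of_nonneg_right h2 hMi.le
    linarith [h3, h4]

-- the structure-update backgrounds of the registered signature unfold slowly
set_option synthInstance.maxHeartbeats 200000 in
set_option maxHeartbeats 3200000 in
/-- **Stub `stub_normalisedEraTwoOfConcl`** (line `registered` of crux `LogTimeThreeAnnuli.DyadicCapture`,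
stmt-FinalStateConjecture-17488, skeleton v7, stub B — backward / necessity): for ONE maximal
development, the settling conjunct `CONCL(𝒟)` (a sub-extremal `C²` final state decomposition `d'`
of `O' = exteriorOf 𝒟 d'.charted` with rays in `closure O'`, exhaustive charts and future-oriented
chart times) already provides a `C⁰`-normalised honest era system at order two: `d := d'.toQuasi _`
(`⊤ > 0`; `charted`, `certifiedLate`, `certifiedSlab`, `background` agree by `rfl`), `O := O'`, the
radii of `HasExhaustiveCharts d'`, the window of `dyadicNecessity_window` around the labels
`(Mᵢ, aᵢ)`, windowed closeness witnessed by the labels themselves (`Tendsto … (𝓝 0)` gives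
`∀ᶠ τ, … ≤ ε`), the `C⁰` normalisation by monotonicity of the `Cᵏ` sup norms in `k`, and the
covector orientation clause from clause (ii) of `IsFutureOriented d'` and `C²` (hence `C⁰`)
convergence by `dyadicNecessity_eventually_pos_symm_apply_zero`. It certifies that the open stub
`stub_normalisedEraTwo` of the skeleton is EQUIVALENT to the crux. Dafermos–Luk arXiv:1710.01722,
Conjecture 1 (b)–(c); O'Neill 1983, Ch. 5, p. 145; Dafermos–Rodnianski arXiv:0811.0354, §5.1.
[cite: DafermosLuk2017, Conjecture 1 (b)–(c)] [cite: arXiv08110354, §5.1] -/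
theorem stub_normalisedEraTwoOfConcl : ∀ (X : Type) [TopologicalSpace X] [ChartedSpace E3 X] [IsManifold (𝓡 3) ((⊤ : ℕ∞) : WithTop ℕ∞) X] [T2Space X] [SecondCountableTopology X] [ConnectedSpace X], ∀ D ∈ admissibleVacuumData X, ∀ 𝒟 : VacuumCauchyDevelopment D, 𝒟.IsMaximal → Summit.FinalStateConjecture.HasCompleteNullInfinity 𝒟.toCauchyDevelopment → (∃ (O' : Set 𝒟.carrier) (d' : FinalStateDecomposition 𝒟.toSpacetime O' 2), (∀ i, Kerr.IsSubextremal (d'.mass i) (d'.spin i)) ∧ O' = Summit.FinalStateConjecture.exteriorOf 𝒟.toCauchyDevelopment d'.charted ∧ Summit.FinalStateConjecture.RaysStayInClosure 𝒟.toCauchyDevelopment O' ∧ Summit.FinalStateConjecture.HasExhaustiveCharts d' ∧ Summit.FinalStateConjecture.IsFutureOriented d') → ∃ (m₀ χ : ℝ) (O : Set 𝒟.carrier) (d : QuasiFinalStateDecomposition 𝒟.toSpacetime O 2 ⊤) (R : Fin d.N → ℝ → ℝ), 0 < m₀ ∧ χ < 1 ∧ O = Summit.FinalStateConjecture.exteriorOf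 𝒟.toCauchyDevelopment d.charted ∧ Summit.FinalStateConjecture.RaysStayInClosure 𝒟.toCauchyDevelopment O ∧ (∀ i : Fin d.N, Filter.Tendsto (R i) Filter.atTop Filter.atTop ∧ ∀ τ : ℝ, max (Kerr.rPlus (d.mass i) (d.spin i)) 0 + 1 ≤ R i τ) ∧ (∀ τ₁ : ℝ, d.τ₀ < τ₁ → O \ d.certifiedLate R τ₁ ⊆ 𝒟.metric.causalPast 𝒟.timeOrientation (d.certifiedSlab R τ₁)) ∧ (∀ i : Fin d.N, Summit.FinalStateConjecture.IsOrthochronous (d.motion i).1) ∧ (∀ (i : Fin d.N) (ρ : ℝ), ∀ᶠ τ in Filter.atTop, ∀ x ∈ (d.background i).truncTimeSlab ρ τ, ∀ w : E4, 𝒟.timeOrientation.IsFutureDirected (mfderiv 𝓘(ℝ, E4) (𝓡 4) (d.chart i) x w) → 0 < ((d.motion i).1 : E4 ≃L[ℝ] E4).symm w 0) ∧ (∀ᶠ τ in Filter.atTop, ∀ x ∈ (Minkowski.backgroundOn d.flatDomain).timeSlab τ, 𝒟.timeOrientation.IsFutureDirected (mfderiv 𝓘(ℝ, E4) (𝓡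 4) d.flatChart x (E4.basisVector 0))) ∧ Filter.Tendsto (fun τ => 𝒟.toSpacetime.deviationCk (Minkowski.backgroundOn d.flatDomain) d.flatChart 2 τ) Filter.atTop (nhds 0) ∧ (∀ (i : Fin d.N) (ρ : ℝ) (ε : ENNReal), 0 < ε → ∀ᶠ τ in Filter.atTop, ∃ M a : ℝ, m₀ ≤ M ∧ M ≤ m₀⁻¹ ∧ |a| ≤ χ * M ∧ 𝒟.toSpacetime.truncDeviationCk {d.background i with bilin := boostedKerrBilin (d.motion i).1 (d.motion i).2 M a} (d.chart i) 2 ρ τ ≤ ε ∧ 𝒟.toSpacetime.truncDeviationCk {d.background i with bilin := boostedKerrBilin (d.motion i).1 (d.motion i).2 M a} (d.chart i) 2 (R i τ) τ ≤ ε) ∧ (∀ (i : Fin d.N) (ρ : ℝ), Filter.Tendsto (fun τ => 𝒟.toSpacetime.truncDeviationCk {d.background i with bilin := boostedKerrBilin (d.motion i).1 (d.motion i).2 (d.mass i) (d.spin i)} (d.chart i) 0 ρ τ) Filter.atTop (nhds 0)) := by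
  intro X _ _ _ _ _ _ D _hD 𝒟 _hmax _hI hconcl
  obtain ⟨O', d', hsub, hO, hrays, ⟨R, hR, hgrow, hexh⟩, horth, hvec, hflat0⟩ := hconcl
  obtain ⟨m₀, χ, hm₀, hχ, hwin⟩ :=
    dyadicNecessity_window d'.mass d'.spin fun i => ⟨(hsub i).pos, hsub i⟩
  refine ⟨m₀, χ, O', d'.toQuasi ENNReal.zero_lt_top, R, hm₀, hχ, hO, hrays, hR, hexh, horth,
    fun i ρ => ?_, hflat0, d'.tendsto_deviationCk_flat, fun i ρ ε hε => ?_, fun i ρ => ?_⟩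
  · -- the covector orientation clause, from clause (ii) of `IsFutureOriented d'`
    exact dyadicNecessity_eventually_pos_symm_apply_zero (d'.motion i).1 (d'.motion i).2 (hsub i)
      (d'.chart i) ρ (d'.tendsto_truncDeviationCk i ρ) (hvec i ρ)
  · -- windowed closeness, witnessed by the labels `(Mᵢ, aᵢ)` themselves
    obtain ⟨h1, h2, h3⟩ := hwin i
    filter_upwards [(d'.tendsto_truncDeviationCk i ρ).eventually (ge_mem_nhds hε),
      (hgrow i).eventually (ge_mem_nhds hε)] with τ hτ₁ hτ₂
    exact ⟨d'.mass i, d'.spin i, h1, h2, h3, hτ₁, hτ₂⟩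
  · -- `C⁰` normalisation: the order-`0` deviation is at most the order-`2` one, which tends to `0`
    exact tendsto_of_tendsto_of_tendsto_of_le_of_le tendsto_const_nhds
      (d'.tendsto_truncDeviationCk i ρ) (fun _ => zero_le)
      fun τ => supCkENorm_mono_right _ (Nat.zero_le 2) _

end Summit.FinalStateConjecture.FinalStateConjecture.Theorems

end
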